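import Literature.MathematicalPhysics.QuantumManyBody.GroundStateFeynmanKacDisplacement
import Mathlib.MeasureTheory.Integral.IntervalIntegral.FundThmCalculus
import Mathlib.Analysis.Calculus.Deriv.Slope
import Mathlib.MeasureTheory.Function.L2Space
import Mathlib.Probability.Moments.Variance
import HarnessLib

/-!
# Ground-state Feynman–Kac: the free small-time form (Gaussian-averaged squared increments)

Topic `Literature/MathematicalPhysics/QuantumManyBody`; support file for the proof of the named
fact `Literature.MathematicalPhysics.QuantumManyBody.BoseGas.GroundStateFeynmanKac`, part of the
variational identification of the top of the spectrum of the Feynman–Kac semigroup with the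
Dirichlet form (Chung–Zhao (1995) Thm 3.27, Prop 3.29 (81)) by direct small-time analysis. The
FREE part of that analysis is the object of this file: for `f : (ℝ³)^N → ℝ` and `t ≥ 0`,

  `sqIncr t f = E ∫ (f(X + √2 b_t) - f(X))² dX ∈ [0, ∞]`,

the Gaussian-averaged squared increment, i.e. `2 (‖f‖² - ⟨f, e^{tΔ} f⟩)` — twice `t` times the
finite-difference Dirichlet form of the free heat semigroup at speed `2`. Proved here:

* `integral_mul_integral_shift_eq` — **the square identity**
  `∫ f(X) E[f(X + √2 b_t)] dX = ‖f‖₂² - sqIncr t f / 2` for `f ∈ L²` (translation invariance);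
* `sqIncr_le_kinetic` — **the `C¹` upper bound** `sqIncr t φ ≤ 2t ∫ |∇φ|²` for every `C¹`
  function `φ` (fundamental theorem of calculus along the segment, Jensen, translation
  invariance of Lebesgue measure, and the covariance `E[ℓ(√2 b_t)²] = 2t ∑ ℓ(e_{ik})²`), where
  `realKinetic φ X = ∑_{i,k} |∂_{ik} φ(X)|²` is the real form of `kineticDensity`
  (`kineticDensity_ofReal`);
* `kinetic_le_liminf_sqIncr` — **the Fatou lower bound**
  `∫ |∇φ|² ≤ liminf_{t → 0⁺} sqIncr t φ / (2t)` for `C¹` `φ` (scaling representation through the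
  standard Gaussian, pointwise convergence of difference quotients, Fatou);
* `sqIncr_conv_le` — **mollification does not increase it**: for a probability measure `ν` and
  bounded measurable `g`, `sqIncr t (x ↦ ∫ g(x - y) dν(y)) ≤ sqIncr t g` (Jensen and translation
  invariance);
* `sqIncr_dilate` — **exact dilation covariance**
  `sqIncr t (X ↦ g(θ X + w)) = θ^{-3N} sqIncr (θ² t) g`.

These are the free ingredients of both inequalities `E₀ ≤ λ₀` and `λ₀ ≤ E₀` between the
variational ground-state energy and the top of the spectrum of the semigroup.

## References

* K. L. Chung, Z. Zhao, *From Brownian Motion to Schrödinger's Equation* (1995), Thm 3.27,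
  Prop 3.29 (81). [ChungZhao1995]
* M. Fukushima, Y. Oshima, M. Takeda, *Dirichlet Forms and Symmetric Markov Processes* (2011),
  §1.3–1.4 (the form of a symmetric semigroup as the limit of `t⁻¹ ⟨f - T_t f, f⟩`). [folklore]
-/

noncomputable section

namespace Literature.MathematicalPhysics.QuantumManyBody.BoseGas

open MeasureTheory ProbabilityTheory Filter Set intervalIntegral
open scoped ENNReal NNReal Topology
open Literature.Probability.Process

variable {N : ℕ}

/-! ### The Gaussian-averaged squared increment and the real kinetic density -/

/-- The **Gaussian-averaged squared increment** `E ∫ (f(X + √2 b_t) - f(X))² dX ∈ [0, ∞]` of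
`f : (ℝ³)^N → ℝ` at time `t` (twice `‖f‖² - ⟨f, e^{tΔ}f⟩`). [folklore] -/
def sqIncr (t : ℝ≥0) (f : Config N → ℝ) : ℝ≥0∞ :=
  ∫⁻ ω, ∫⁻ X, ENNReal.ofReal ((f (X + displacement t ω) - f X) ^ 2) ∂volume ∂wienerPaths N

/-- The **real kinetic density** `|∇φ(X)|² = ∑_{i,k} |∂_{ik} φ(X)|²` of a real function, in the
coordinates of `kineticDensity`. [cite: LSSY2005, §1.2 (1.16)] -/
def realKinetic (φ : Config N → ℝ) (X : Config N) : ℝ≥0∞ :=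
  ∑ i, ∑ k, (‖fderiv ℝ φ X (Pi.single i (EuclideanSpace.single k (1 : ℝ)))‖₊ : ℝ≥0∞) ^ 2

/-- The real kinetic density as `ofReal` of the sum of squares. [folklore] -/
theorem realKinetic_eq_ofReal (φ : Config N → ℝ) (X : Config N) :
    realKinetic φ X = ENNReal.ofReal
      (∑ i, ∑ k, (fderiv ℝ φ X (Pi.single i (EuclideanSpace.single k (1 : ℝ)))) ^ 2) := by
  rw [realKinetic, ENNReal.ofReal_sum_of_nonneg (fun i _ => Finset.sum_nonneg fun k _ => sq_nonneg _)]
  refine Finset.sum_congr rfl fun i _ => ?_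
  rw [ENNReal.ofReal_sum_of_nonneg (fun k _ => sq_nonneg _)]
  refine Finset.sum_congr rfl fun k _ => ?_
  rw [← ENNReal.coe_pow, ← ENNReal.ofReal_coe_nnreal]
  congr 1
  push_cast
  rw [Real.norm_eq_abs, sq_abs]

/-- `‖(x : ℂ)‖₊ = ‖x‖₊`. [folklore] -/
theorem nnnorm_real_complex (x : ℝ) : ‖(x : ℂ)‖₊ = ‖x‖₊ := by
  ext; simp

/-- **The kinetic density of a real wave function**: `kineticDensity (φ : ℂ) = realKinetic φ`.
[folklore] -/
theorem kineticDensity_ofReal {φ : Config N → ℝ} (hφ : Differentiable ℝ φ) (X : Config N) :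
    kineticDensity (fun Y => (φ Y : ℂ)) X = realKinetic φ X := by
  unfold kineticDensity realKinetic
  have hd : fderiv ℝ (fun Y => (φ Y : ℂ)) X = Complex.ofRealCLM.comp (fderiv ℝ φ X) :=
    (Complex.ofRealCLM.hasFDerivAt.comp X (hφ X).hasFDerivAt).fderiv
  refine Finset.sum_congr rfl fun i _ => Finset.sum_congr rfl fun k _ => ?_
  rw [hd]
  simp only [ContinuousLinearMap.coe_comp, Function.comp_apply, Complex.ofRealCLM_apply]
  rw [nnnorm_real_complex]

/-- The real kinetic density is measurable for `C¹` functions. [folklore] -/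
theorem measurable_realKinetic {φ : Config N → ℝ} (hφ : ContDiff ℝ 1 φ) :
    Measurable (realKinetic φ) := by
  unfold realKinetic
  refine Finset.measurable_sum _ fun i _ => Finset.measurable_sum _ fun k _ => ?_
  have hc : Continuous fun X => fderiv ℝ φ X (Pi.single i (EuclideanSpace.single k (1 : ℝ))) :=
    (hφ.continuous_fderiv one_ne_zero).clm_apply continuous_const
  exact (hc.nnnorm.measurable.coe_nnreal_ennreal).pow_const _

/-! ### Measurability and finiteness -/

/-- Joint measurability of `(ω, X) ↦ f(X + √2 b_t(ω))`. [folklore] -/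
theorem measurable_comp_add_displacement {f : Config N → ℝ} (hf : Measurable f) (t : ℝ≥0) :
    Measurable fun p : PathSpace N × Config N => f (p.2 + displacement t p.1) :=
  hf.comp (measurable_snd.add ((measurable_displacement t).comp measurable_fst))

/-- The squared-increment integrand is jointly measurable. [folklore] -/
theorem measurable_sqIncr_integrand {f : Config N → ℝ} (hf : Measurable f) (t : ℝ≥0) :
    Measurable fun p : PathSpace N × Config N =>
      ENNReal.ofReal ((f (p.2 + displacement t p.1) - f p.2) ^ 2) :=
  ENNReal.measurable_ofReal.comp
    (((measurable_comp_add_displacement hf t).sub (hf.comp measurable_snd)).pow_const 2)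

/-- The shift functional `S_f(h) = ∫ (f(X + h) - f X)² dX` is measurable in the shift. [folklore] -/
theorem measurable_lintegral_shift_sq {f : Config N → ℝ} (hf : Measurable f) :
    Measurable fun h : Config N => ∫⁻ X, ENNReal.ofReal ((f (X + h) - f X) ^ 2) := by
  have hm : Measurable fun p : Config N × Config N => ENNReal.ofReal ((f (p.2 + p.1) - f p.2) ^ 2) :=
    ENNReal.measurable_ofReal.comp
      (((hf.comp (measurable_snd.add measurable_fst)).sub (hf.comp measurable_snd)).pow_const 2)
  exact hm.lintegral_prod_right'

/-- `sqIncr` through the shift functional: `sqIncr t f = E[S_f(√2 b_t)]`. [folklore] -/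
theorem sqIncr_eq_lintegral_shift (t : ℝ≥0) (f : Config N → ℝ) :
    sqIncr t f = ∫⁻ ω, (fun h : Config N => ∫⁻ X, ENNReal.ofReal ((f (X + h) - f X) ^ 2))
      (displacement t ω) ∂wienerPaths N := rfl

/-- At `t = 0` there is no increment. [folklore] -/
@[simp] theorem sqIncr_zero (f : Config N → ℝ) : sqIncr 0 f = 0 := by
  simp [sqIncr]

/-- Elementary bound `(a - b)² ≤ 2a² + 2b²`. [folklore] -/
theorem sub_sq_le_two_mul (a b : ℝ) : (a - b) ^ 2 ≤ 2 * a ^ 2 + 2 * b ^ 2 := by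
  nlinarith [sq_nonneg (a + b)]

/-- The shift functional is bounded by `4 ‖f‖₂²`. [folklore] -/
theorem lintegral_shift_sq_le {f : Config N → ℝ} (hf : Measurable f) (h : Config N) :
    ∫⁻ X, ENNReal.ofReal ((f (X + h) - f X) ^ 2) ≤ 4 * ∫⁻ X, ENNReal.ofReal (f X ^ 2) := by
  have hm0 : Measurable fun X : Config N => ENNReal.ofReal (f X ^ 2) :=
    ENNReal.measurable_ofReal.comp (hf.pow_const 2)
  have hm1 : Measurable fun X : Config N => ENNReal.ofReal (f (X + h) ^ 2) :=
    ENNReal.measurable_ofReal.comp ((hf.comp (measurable_add_const h)).pow_const 2)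
  have hpt : ∀ X : Config N, ENNReal.ofReal ((f (X + h) - f X) ^ 2) ≤
      2 * ENNReal.ofReal (f (X + h) ^ 2) + 2 * ENNReal.ofReal (f X ^ 2) := fun X => by
    calc ENNReal.ofReal ((f (X + h) - f X) ^ 2)
        ≤ ENNReal.ofReal (2 * f (X + h) ^ 2 + 2 * f X ^ 2) :=
          ENNReal.ofReal_le_ofReal (sub_sq_le_two_mul _ _)
      _ = 2 * ENNReal.ofReal (f (X + h) ^ 2) + 2 * ENNReal.ofReal (f X ^ 2) := by
          rw [ENNReal.ofReal_add (by positivity) (by positivity), ENNReal.ofReal_mul zero_le_two,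
            ENNReal.ofReal_mul zero_le_two, ENNReal.ofReal_ofNat]
  have htrans : ∫⁻ X, ENNReal.ofReal (f (X + h) ^ 2) = ∫⁻ X, ENNReal.ofReal (f X ^ 2) :=
    lintegral_add_right_eq_self (μ := (volume : Measure (Config N)))
      (fun X => ENNReal.ofReal (f X ^ 2)) h
  calc ∫⁻ X, ENNReal.ofReal ((f (X + h) - f X) ^ 2)
      ≤ ∫⁻ X, (2 * ENNReal.ofReal (f (X + h) ^ 2) + 2 * ENNReal.ofReal (f X ^ 2)) :=
        lintegral_mono hpt
    _ = (2 * ∫⁻ X, ENNReal.ofReal (f (X + h) ^ 2)) + 2 * ∫⁻ X, ENNReal.ofReal (f X ^ 2) := by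
        rw [lintegral_add_left (hm1.const_mul 2), lintegral_const_mul 2 hm1,
          lintegral_const_mul 2 hm0]
    _ = 4 * ∫⁻ X, ENNReal.ofReal (f X ^ 2) := by
        rw [htrans, ← add_mul]
        norm_num

/-- `sqIncr t f ≤ 4 ‖f‖₂²`. [folklore] -/
theorem sqIncr_le {f : Config N → ℝ} (hf : Measurable f) (t : ℝ≥0) :
    sqIncr t f ≤ 4 * ∫⁻ X, ENNReal.ofReal (f X ^ 2) := by
  calc sqIncr t f ≤ ∫⁻ _ω, (4 * ∫⁻ X, ENNReal.ofReal (f X ^ 2)) ∂wienerPaths N :=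
        lintegral_mono fun ω => lintegral_shift_sq_le hf _
    _ = 4 * ∫⁻ X, ENNReal.ofReal (f X ^ 2) := by
        rw [lintegral_const, measure_univ, mul_one]

/-- `sqIncr t f < ∞` for `f ∈ L²`. [folklore] -/
theorem sqIncr_lt_top {f : Config N → ℝ} (hf : Measurable f)
    (hf2 : ∫⁻ X, ENNReal.ofReal (f X ^ 2) ≠ ⊤) (t : ℝ≥0) : sqIncr t f < ⊤ :=
  (sqIncr_le hf t).trans_lt (ENNReal.mul_lt_top (by norm_num) hf2.lt_top)

/-! ### The square identity -/

/-- Jensen on a probability space in the form `(∫ u)² ≤ ∫ u²` (nonnegativity of the variance).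
[folklore] -/
theorem sq_integral_le_integral_sq {α : Type*} [MeasurableSpace α] {μ : Measure α}
    [IsProbabilityMeasure μ] {u : α → ℝ} (hu : MemLp u 2 μ) :
    (∫ x, u x ∂μ) ^ 2 ≤ ∫ x, u x ^ 2 ∂μ := by
  have h := variance_nonneg u μ
  rw [variance_eq_sub hu] at h
  simp only [Pi.pow_apply] at h
  linarith

/-- The `L²` mass of a real function as a Bochner integral: `(∫⁻ ofReal (f²)).toReal = ∫ f²`.
[folklore] -/
theorem toReal_lintegral_sq {α : Type*} [MeasurableSpace α] {μ : Measure α} {f : α → ℝ}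
    (hf : Integrable (fun x => f x ^ 2) μ) :
    (∫⁻ x, ENNReal.ofReal (f x ^ 2) ∂μ).toReal = ∫ x, f x ^ 2 ∂μ := by
  rw [← ofReal_integral_eq_lintegral_ofReal hf (Eventually.of_forall fun x => sq_nonneg _),
    ENNReal.toReal_ofReal (integral_nonneg fun x => sq_nonneg _)]

/-- A translate of an `L²` function is `L²`. [folklore] -/
theorem memLp_two_comp_add {f : Config N → ℝ} (hf2 : MemLp f 2 volume) (h : Config N) :
    MemLp (fun X => f (X + h)) 2 volume :=
  hf2.comp_measurePreserving (measurePreserving_add_right volume h)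

/-- **The square identity for a fixed shift**:
`∫ f(X) f(X + h) dX = ∫ f² - ½ ∫ (f(X + h) - f X)² dX` for `f ∈ L²`. [folklore] -/
theorem integral_mul_shift_eq {f : Config N → ℝ} (hf2 : MemLp f 2 volume) (h : Config N) :
    ∫ X, f X * f (X + h) = (∫ X, f X ^ 2) - (1 / 2) * ∫ X, (f (X + h) - f X) ^ 2 := by
  have hsq : Integrable (fun X => f X ^ 2) volume := hf2.integrable_sq
  have hsqh : Integrable (fun X => f (X + h) ^ 2) volume := (memLp_two_comp_add hf2 h).integrable_sq
  have hprod : Integrable (fun X => f X * f (X + h)) volume :=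
    hf2.integrable_mul (memLp_two_comp_add hf2 h)
  have hexp : ∀ X, (f (X + h) - f X) ^ 2 = f (X + h) ^ 2 - 2 * (f X * f (X + h)) + f X ^ 2 := by
    intro X; ring
  simp_rw [hexp]
  have h1 : Integrable (fun X => f (X + h) ^ 2 - 2 * (f X * f (X + h))) volume :=
    hsqh.sub (hprod.const_mul 2)
  have htrans : ∫ X, f (X + h) ^ 2 = ∫ X, f X ^ 2 :=
    integral_add_right_eq_self (μ := (volume : Measure (Config N))) (fun X => f X ^ 2) h
  rw [integral_add h1 hsq, integral_sub hsqh (hprod.const_mul 2), MeasureTheory.integral_const_mul,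
    htrans]
  ring

/-- Joint integrability of `(X, ω) ↦ f(X + √2 b_t(ω))²` for `f ∈ L²`, with
`∫∫ f(X + √2 b_t)² = ‖f‖₂²`. [folklore] -/
theorem lintegral_prod_sq_comp_add_displacement {f : Config N → ℝ} (hf : Measurable f) (t : ℝ≥0) :
    ∫⁻ p : Config N × PathSpace N, ENNReal.ofReal (f (p.1 + displacement t p.2) ^ 2)
      ∂(volume.prod (wienerPaths N)) = ∫⁻ X, ENNReal.ofReal (f X ^ 2) := by
  have hm : Measurable fun p : Config N × PathSpace N =>
      ENNReal.ofReal (f (p.1 + displacement t p.2) ^ 2) :=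
    ENNReal.measurable_ofReal.comp
      ((hf.comp (measurable_fst.add ((measurable_displacement t).comp measurable_snd))).pow_const 2)
  rw [lintegral_prod_symm _ hm.aemeasurable]
  simp only
  have : ∀ ω : PathSpace N, ∫⁻ X, ENNReal.ofReal (f (X + displacement t ω) ^ 2) =
      ∫⁻ X, ENNReal.ofReal (f X ^ 2) := fun ω =>
    lintegral_add_right_eq_self (μ := (volume : Measure (Config N)))
      (fun X => ENNReal.ofReal (f X ^ 2)) _
  simp_rw [this]
  rw [lintegral_const, measure_univ, mul_one]

/-- The pairing integrand `(X, ω) ↦ f(X) f(X + √2 b_t(ω))` is integrable on the product for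
`f ∈ L²` (`|ab| ≤ (a² + b²)/2`, Tonelli, translation invariance). [folklore] -/
theorem integrable_mul_comp_add_displacement {f : Config N → ℝ} (hf : Measurable f)
    (hf2 : MemLp f 2 volume) (t : ℝ≥0) :
    Integrable (fun p : Config N × PathSpace N => f p.1 * f (p.1 + displacement t p.2))
      (volume.prod (wienerPaths N)) := by
  have hmeas : Measurable fun p : Config N × PathSpace N => f p.1 * f (p.1 + displacement t p.2) :=
    (hf.comp measurable_fst).mul
      (hf.comp (measurable_fst.add ((measurable_displacement t).comp measurable_snd)))
  refine ⟨hmeas.aestronglyMeasurable, ?_⟩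
  have hsq : ∫⁻ X, ENNReal.ofReal (f X ^ 2) < ⊤ := by
    have := hf2.integrable_sq
    exact (hasFiniteIntegral_iff_ofReal (Eventually.of_forall fun X => sq_nonneg _)).1 this.2
  refine lt_of_le_of_lt (lintegral_mono fun p => ?_ : ∫⁻ p, ‖f p.1 * f (p.1 + displacement t p.2)‖ₑ
      ∂(volume.prod (wienerPaths N)) ≤
      ∫⁻ p, (ENNReal.ofReal (f p.1 ^ 2) + ENNReal.ofReal (f (p.1 + displacement t p.2) ^ 2))
        ∂(volume.prod (wienerPaths N))) ?_
  · rw [Real.enorm_eq_ofReal_abs, ← ENNReal.ofReal_add (sq_nonneg _) (sq_nonneg _)]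
    refine ENNReal.ofReal_le_ofReal ?_
    rw [abs_mul]
    nlinarith [sq_nonneg (|f p.1| - |f (p.1 + displacement t p.2)|), sq_abs (f p.1),
      sq_abs (f (p.1 + displacement t p.2))]
  · have hmA : Measurable fun p : Config N × PathSpace N => ENNReal.ofReal (f p.1 ^ 2) :=
      ENNReal.measurable_ofReal.comp ((hf.comp measurable_fst).pow_const 2)
    rw [lintegral_add_left hmA, lintegral_prod_sq_comp_add_displacement hf t]
    have h1 : ∫⁻ p : Config N × PathSpace N, ENNReal.ofReal (f p.1 ^ 2) ∂(volume.prod (wienerPaths N))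
        = ∫⁻ X, ENNReal.ofReal (f X ^ 2) := by
      rw [lintegral_prod _ hmA.aemeasurable]
      simp only [lintegral_const, measure_univ, mul_one]
    rw [h1]
    exact ENNReal.add_lt_top.2 ⟨hsq, hsq⟩

/-- The shift functional along the displacement is integrable in the sample and its expectation
is `sqIncr` (read in `ℝ`). [folklore] -/
theorem integral_shift_sq_displacement {f : Config N → ℝ} (hf : Measurable f)
    (hf2 : MemLp f 2 volume) (t : ℝ≥0) :
    Integrable (fun ω : PathSpace N => ∫ X, (f (X + displacement t ω) - f X) ^ 2) (wienerPaths N) ∧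
    ∫ ω, (∫ X, (f (X + displacement t ω) - f X) ^ 2) ∂wienerPaths N = (sqIncr t f).toReal := by
  have hsq : ∫⁻ X, ENNReal.ofReal (f X ^ 2) ≠ ⊤ := by
    have := hf2.integrable_sq
    exact ((hasFiniteIntegral_iff_ofReal (Eventually.of_forall fun X => sq_nonneg _)).1 this.2).ne
  -- the inner integral as `toReal` of the inner lower integral
  have hinner : ∀ ω : PathSpace N, ∫ X, (f (X + displacement t ω) - f X) ^ 2 =
      (∫⁻ X, ENNReal.ofReal ((f (X + displacement t ω) - f X) ^ 2)).toReal := by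
    intro ω
    have hint : Integrable (fun X => (f (X + displacement t ω) - f X) ^ 2) volume := by
      have := ((memLp_two_comp_add hf2 (displacement t ω)).sub hf2).integrable_sq
      exact this
    rw [← ofReal_integral_eq_lintegral_ofReal hint (Eventually.of_forall fun X => sq_nonneg _),
      ENNReal.toReal_ofReal (integral_nonneg fun X => sq_nonneg _)]
  have hmeas : Measurable fun ω : PathSpace N =>
      ∫⁻ X, ENNReal.ofReal ((f (X + displacement t ω) - f X) ^ 2) :=
    (measurable_lintegral_shift_sq hf).comp (measurable_displacement t)
  have hbound : ∀ ω : PathSpace N, ∫⁻ X, ENNReal.ofReal ((f (X + displacement t ω) - f X) ^ 2) ≤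
      4 * ∫⁻ X, ENNReal.ofReal (f X ^ 2) := fun ω => lintegral_shift_sq_le hf _
  have hlt : ∀ ω : PathSpace N, ∫⁻ X, ENNReal.ofReal ((f (X + displacement t ω) - f X) ^ 2) < ⊤ :=
    fun ω => (hbound ω).trans_lt (ENNReal.mul_lt_top (by norm_num) hsq.lt_top)
  simp_rw [hinner]
  constructor
  · refine (integrable_toReal_of_lintegral_ne_top hmeas.aemeasurable ?_)
    refine ne_of_lt (lt_of_le_of_lt (lintegral_mono hbound) ?_)
    rw [lintegral_const, measure_univ, mul_one]
    exact ENNReal.mul_lt_top (by norm_num) hsq.lt_top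
  · rw [integral_toReal hmeas.aemeasurable (Eventually.of_forall hlt)]
    rfl

/-- **The square identity**: for `f ∈ L²((ℝ³)^N)` and every `t`,
`∫ f(X) E[f(X + √2 b_t)] dX = ‖f‖₂² - sqIncr t f / 2` (Fubini, then the fixed-shift identity
`∫ f f(· + h) = ‖f‖² - ½‖f(· + h) - f‖²`). [folklore] -/
theorem integral_mul_integral_shift_eq {f : Config N → ℝ} (hf : Measurable f)
    (hf2 : MemLp f 2 volume) (t : ℝ≥0) :
    ∫ X, f X * ∫ ω, f (X + displacement t ω) ∂wienerPaths N =
      (∫ X, f X ^ 2) - (sqIncr t f).toReal / 2 := by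
  have hI := integrable_mul_comp_add_displacement hf hf2 t
  calc ∫ X, f X * ∫ ω, f (X + displacement t ω) ∂wienerPaths N
      = ∫ X, (∫ ω, f X * f (X + displacement t ω) ∂wienerPaths N) := by
        refine integral_congr_ae (Eventually.of_forall fun X => ?_)
        exact (MeasureTheory.integral_const_mul _ _).symm
    _ = ∫ ω, (∫ X, f X * f (X + displacement t ω)) ∂wienerPaths N := integral_integral_swap hI
    _ = ∫ ω, ((∫ X, f X ^ 2) - (1 / 2) * ∫ X, (f (X + displacement t ω) - f X) ^ 2) ∂wienerPaths N := by
        refine integral_congr_ae (Eventually.of_forall fun ω => ?_)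
        exact integral_mul_shift_eq hf2 _
    _ = (∫ X, f X ^ 2) - (sqIncr t f).toReal / 2 := by
        obtain ⟨hint, heq⟩ := integral_shift_sq_displacement hf hf2 t
        rw [integral_sub (integrable_const _) (hint.const_mul _), MeasureTheory.integral_const,
          MeasureTheory.integral_const_mul, heq]
        simp only [probReal_univ, one_smul]
        ring

/-! ### The `C¹` upper bound `sqIncr t φ ≤ 2t ∫ |∇φ|²` -/

/-- Derivative along a segment: `s ↦ φ(X + s h)` has derivative `Dφ(X + s h) h`. [folklore] -/
theorem hasDerivAt_comp_lineMap {φ : Config N → ℝ} (hφ : ContDiff ℝ 1 φ) (X h : Config N) (s : ℝ) :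
    HasDerivAt (fun s : ℝ => φ (X + s • h)) (fderiv ℝ φ (X + s • h) h) s := by
  have hline : HasDerivAt (fun s : ℝ => X + s • h) h s := by
    simpa using ((hasDerivAt_id s).smul_const h).const_add X
  exact ((hφ.differentiable one_ne_zero) (X + s • h)).hasFDerivAt.comp_hasDerivAt s hline

/-- The derivative along a segment is continuous in the parameter. [folklore] -/
theorem continuous_fderiv_lineMap {φ : Config N → ℝ} (hφ : ContDiff ℝ 1 φ) (X h : Config N) :
    Continuous fun s : ℝ => fderiv ℝ φ (X + s • h) h :=
  ((hφ.continuous_fderiv one_ne_zero).comp (by fun_prop)).clm_apply continuous_const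

/-- **Fundamental theorem of calculus + Jensen along the segment**:
`(φ(X + h) - φ(X))² ≤ ∫₀¹ (Dφ(X + s h) h)² ds` for `C¹` `φ`. [folklore] -/
theorem sq_sub_le_integral_sq_fderiv {φ : Config N → ℝ} (hφ : ContDiff ℝ 1 φ) (X h : Config N) :
    (φ (X + h) - φ X) ^ 2 ≤ ∫ s in (0 : ℝ)..1, (fderiv ℝ φ (X + s • h) h) ^ 2 := by
  have hcont := continuous_fderiv_lineMap hφ X h
  -- FTC
  have hftc : ∫ s in (0 : ℝ)..1, fderiv ℝ φ (X + s • h) h = φ (X + h) - φ X := by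
    have := integral_eq_sub_of_hasDerivAt (a := 0) (b := 1)
      (fun s _ => hasDerivAt_comp_lineMap hφ X h s) (hcont.intervalIntegrable 0 1)
    simpa using this
  rw [← hftc, integral_of_le zero_le_one, integral_of_le zero_le_one]
  -- Jensen on the probability space `(Ioc 0 1, ds)`
  haveI : IsProbabilityMeasure ((volume : Measure ℝ).restrict (Set.Ioc 0 1)) :=
    ⟨by simp⟩
  refine sq_integral_le_integral_sq ?_
  obtain ⟨C, hC⟩ := isCompact_Icc.exists_bound_of_continuousOn (s := Set.Icc (0 : ℝ) 1)
    hcont.continuousOn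
  refine MemLp.of_bound hcont.aestronglyMeasurable C ?_
  rw [ae_restrict_iff' measurableSet_Ioc]
  exact Eventually.of_forall fun s hs => hC s (Set.Ioc_subset_Icc_self hs)

/-- **Integrated form**: `∫ (φ(X + h) - φ X)² dX ≤ ∫ (Dφ(Y) h)² dY` (Tonelli and translation
invariance of Lebesgue measure). [folklore] -/
theorem lintegral_sq_sub_le {φ : Config N → ℝ} (hφ : ContDiff ℝ 1 φ) (h : Config N) :
    ∫⁻ X, ENNReal.ofReal ((φ (X + h) - φ X) ^ 2) ≤
      ∫⁻ Y, ENNReal.ofReal ((fderiv ℝ φ Y h) ^ 2) := by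
  have hcont2 : Continuous fun p : Config N × ℝ => (fderiv ℝ φ (p.1 + p.2 • h) h) ^ 2 :=
    (((hφ.continuous_fderiv one_ne_zero).comp (by fun_prop)).clm_apply continuous_const).pow 2
  calc ∫⁻ X, ENNReal.ofReal ((φ (X + h) - φ X) ^ 2)
      ≤ ∫⁻ X, ENNReal.ofReal (∫ s in (0 : ℝ)..1, (fderiv ℝ φ (X + s • h) h) ^ 2) :=
        lintegral_mono fun X => ENNReal.ofReal_le_ofReal (sq_sub_le_integral_sq_fderiv hφ X h)
    _ = ∫⁻ X, ∫⁻ s in Set.Ioc (0 : ℝ) 1, ENNReal.ofReal ((fderiv ℝ φ (X + s • h) h) ^ 2) := by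
        refine lintegral_congr fun X => ?_
        have hint : IntegrableOn (fun s : ℝ => (fderiv ℝ φ (X + s • h) h) ^ 2) (Set.Ioc 0 1) volume :=
          (((continuous_fderiv_lineMap hφ X h).pow 2).continuousOn.integrableOn_compact
            isCompact_Icc).mono_set Set.Ioc_subset_Icc_self
        rw [integral_of_le zero_le_one,
          ofReal_integral_eq_lintegral_ofReal hint (Eventually.of_forall fun s => sq_nonneg _)]
    _ = ∫⁻ s in Set.Ioc (0 : ℝ) 1, ∫⁻ X, ENNReal.ofReal ((fderiv ℝ φ (X + s • h) h) ^ 2) :=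
        lintegral_lintegral_swap
          ((ENNReal.measurable_ofReal.comp hcont2.measurable).aemeasurable)
    _ = ∫⁻ _s in Set.Ioc (0 : ℝ) 1, ∫⁻ Y, ENNReal.ofReal ((fderiv ℝ φ Y h) ^ 2) := by
        refine lintegral_congr fun s => ?_
        exact lintegral_add_right_eq_self (μ := (volume : Measure (Config N)))
          (fun Y => ENNReal.ofReal ((fderiv ℝ φ Y h) ^ 2)) (s • h)
    _ = ∫⁻ Y, ENNReal.ofReal ((fderiv ℝ φ Y h) ^ 2) := by
        rw [setLIntegral_const, Real.volume_Ioc, sub_zero, ENNReal.ofReal_one, mul_one]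

/-- A continuous linear functional of the displacement is square integrable. [folklore] -/
theorem memLp_two_clm_displacement (ℓ : Config N →L[ℝ] ℝ) (t : ℝ≥0) :
    MemLp (fun ω : PathSpace N => ℓ (displacement t ω)) 2 (wienerPaths N) := by
  have h : (fun ω : PathSpace N => ℓ (displacement t ω)) = fun ω =>
      ∑ p : Fin N × Fin 3, displacement t ω p.1 p.2 *
        ℓ (Pi.single p.1 (EuclideanSpace.single p.2 (1 : ℝ))) := by
    funext ω; exact clm_displacement_eq_sum ℓ t ω
  rw [h]
  refine memLp_finsetSum _ fun p _ => ?_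
  simp only [displacement_apply]
  have : (fun ω : PathSpace N => Real.sqrt 2 * brownian t (ω p.1 p.2) *
      ℓ (Pi.single p.1 (EuclideanSpace.single p.2 (1 : ℝ)))) = fun ω =>
      (Real.sqrt 2 * ℓ (Pi.single p.1 (EuclideanSpace.single p.2 (1 : ℝ)))) *
        brownian t (ω p.1 p.2) := by
    funext ω; ring
  rw [this]
  exact (memLp_two_brownian_coord t p.1 p.2).const_mul _

/-- `E[ℓ(√2 b_t)²] < ∞`: the square is integrable. [folklore] -/
theorem integrable_clm_displacement_sq (ℓ : Config N →L[ℝ] ℝ) (t : ℝ≥0) :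
    Integrable (fun ω : PathSpace N => (ℓ (displacement t ω)) ^ 2) (wienerPaths N) :=
  (memLp_two_clm_displacement ℓ t).integrable_sq

/-- The lower integral form of the covariance: `∫⁻ ofReal (ℓ(√2 b_t)²) = ofReal (2t ∑ ℓ(e_{ik})²)`.
[folklore] -/
theorem lintegral_clm_displacement_sq (ℓ : Config N →L[ℝ] ℝ) (t : ℝ≥0) :
    ∫⁻ ω, ENNReal.ofReal ((ℓ (displacement t ω)) ^ 2) ∂wienerPaths N =
      ENNReal.ofReal (2 * (t : ℝ) *
        ∑ i, ∑ k, (ℓ (Pi.single i (EuclideanSpace.single k (1 : ℝ)))) ^ 2) := by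
  rw [← ofReal_integral_eq_lintegral_ofReal (integrable_clm_displacement_sq ℓ t)
    (Eventually.of_forall fun ω => sq_nonneg _), integral_clm_displacement_sq]

/-- **The `C¹` upper bound**: `sqIncr t φ ≤ 2t ∫ |∇φ|²` for every `C¹` real function `φ` on
`(ℝ³)^N` (`(φ(X+h)-φ(X))² ≤ ∫₀¹ (Dφ(X+sh)h)²`, translation invariance, and
`E[(Dφ(Y) √2 b_t)²] = 2t |∇φ(Y)|²`). [folklore] -/
theorem sqIncr_le_kinetic {φ : Config N → ℝ} (hφ : ContDiff ℝ 1 φ) (t : ℝ≥0) :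
    sqIncr t φ ≤ ENNReal.ofReal (2 * t) * ∫⁻ Y, realKinetic φ Y := by
  have hjoint : Measurable fun p : PathSpace N × Config N =>
      ENNReal.ofReal ((fderiv ℝ φ p.2 (displacement t p.1)) ^ 2) := by
    have hc : Continuous fun q : Config N × Config N => (fderiv ℝ φ q.1 q.2) ^ 2 :=
      (((hφ.continuous_fderiv one_ne_zero).comp continuous_fst).clm_apply continuous_snd).pow 2
    exact ENNReal.measurable_ofReal.comp (hc.measurable.comp
      (measurable_snd.prodMk ((measurable_displacement t).comp measurable_fst)))
  calc sqIncr t φ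
      ≤ ∫⁻ ω, ∫⁻ Y, ENNReal.ofReal ((fderiv ℝ φ Y (displacement t ω)) ^ 2) ∂volume ∂wienerPaths N :=
        lintegral_mono fun ω => lintegral_sq_sub_le hφ _
    _ = ∫⁻ Y, ∫⁻ ω, ENNReal.ofReal ((fderiv ℝ φ Y (displacement t ω)) ^ 2) ∂wienerPaths N ∂volume :=
        lintegral_lintegral_swap hjoint.aemeasurable
    _ = ∫⁻ Y, ENNReal.ofReal (2 * (t : ℝ) *
          ∑ i, ∑ k, (fderiv ℝ φ Y (Pi.single i (EuclideanSpace.single k (1 : ℝ)))) ^ 2) := by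
        refine lintegral_congr fun Y => ?_
        exact lintegral_clm_displacement_sq (fderiv ℝ φ Y) t
    _ = ENNReal.ofReal (2 * t) * ∫⁻ Y, realKinetic φ Y := by
        rw [← lintegral_const_mul' _ _ ENNReal.ofReal_ne_top]
        refine lintegral_congr fun Y => ?_
        rw [realKinetic_eq_ofReal, ← ENNReal.ofReal_mul (by positivity)]

/-! ### The Fatou lower bound `∫ |∇φ|² ≤ liminf sqIncr t φ / (2t)` -/

/-- A continuous linear functional is square integrable for the standard Gaussian. [folklore] -/
theorem integrable_clm_sq_stdGaussian (ℓ : Config N →L[ℝ] ℝ) :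
    Integrable (fun z => (ℓ z) ^ 2) (stdGaussian N) := by
  rw [← map_displacement_half]
  refine (integrable_map_measure (by fun_prop) (measurable_displacement _).aemeasurable).2 ?_
  exact integrable_clm_displacement_sq ℓ _

/-- Lower-integral second moments of the standard Gaussian:
`∫⁻ ofReal (ℓ z)² dγ = ofReal (∑ ℓ(e_{ik})²)`. [folklore] -/
theorem lintegral_clm_sq_stdGaussian (ℓ : Config N →L[ℝ] ℝ) :
    ∫⁻ z, ENNReal.ofReal ((ℓ z) ^ 2) ∂stdGaussian N =
      ENNReal.ofReal (∑ i, ∑ k, (ℓ (Pi.single i (EuclideanSpace.single k (1 : ℝ)))) ^ 2) := by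
  rw [← ofReal_integral_eq_lintegral_ofReal (integrable_clm_sq_stdGaussian ℓ)
    (Eventually.of_forall fun z => sq_nonneg _), integral_clm_sq_stdGaussian]

/-- **Scaling representation of `sqIncr`**: for `t > 0`,
`sqIncr t f = ∫∫ (f(X + √(2t) z) - f X)² dX dγ(z)`. [folklore] -/
theorem sqIncr_eq_lintegral_stdGaussian {f : Config N → ℝ} (hf : Measurable f) {t : ℝ≥0}
    (ht : t ≠ 0) :
    sqIncr t f = ∫⁻ z, ∫⁻ X, ENNReal.ofReal ((f (X + Real.sqrt (2 * t) • z) - f X) ^ 2)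
      ∂volume ∂stdGaussian N := by
  rw [sqIncr_eq_lintegral_shift]
  exact (lintegral_stdGaussian_smul ht (measurable_lintegral_shift_sq hf)).symm

/-- Pointwise convergence of the rescaled squared increments to the squared directional
derivative: `(φ(X + √(2t) z) - φ X)² / (2t) → (Dφ(X) z)²` as `t → 0⁺`. [folklore] -/
theorem tendsto_sqIncr_integrand {φ : Config N → ℝ} (hφ : ContDiff ℝ 1 φ) (z X : Config N) :
    Tendsto (fun t : ℝ≥0 => (ENNReal.ofReal (2 * t))⁻¹ *
        ENNReal.ofReal ((φ (X + Real.sqrt (2 * t) • z) - φ X) ^ 2))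
      (𝓝[>] 0) (𝓝 (ENNReal.ofReal ((fderiv ℝ φ X z) ^ 2))) := by
  -- the slope of `s ↦ φ(X + s z)` at `0⁺`
  have hder : HasDerivAt (fun s : ℝ => φ (X + s • z)) (fderiv ℝ φ X z) 0 := by
    have h0 := hasDerivAt_comp_lineMap hφ X z 0
    rw [zero_smul, add_zero] at h0
    exact h0
  have hslope : Tendsto (fun s : ℝ => s⁻¹ * (φ (X + s • z) - φ X)) (𝓝[>] 0)
      (𝓝 (fderiv ℝ φ X z)) := by
    have h1 := hder.tendsto_slope_zero_right
    have h2 : (fun s : ℝ => s⁻¹ • (φ (X + (0 + s) • z) - φ (X + (0 : ℝ) • z))) =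
        fun s : ℝ => s⁻¹ * (φ (X + s • z) - φ X) := by
      funext s
      rw [zero_add, zero_smul, add_zero, smul_eq_mul]
    rw [h2] at h1
    exact h1
  -- `t ↦ √(2t)` tends to `0⁺` along `t → 0⁺`
  have hsqrt : Tendsto (fun t : ℝ≥0 => Real.sqrt (2 * t)) (𝓝[>] 0) (𝓝[>] 0) := by
    refine tendsto_nhdsWithin_iff.2 ⟨?_, ?_⟩
    · have hc : Continuous fun t : ℝ≥0 => Real.sqrt (2 * (t : ℝ)) :=
        Real.continuous_sqrt.comp (continuous_const.mul NNReal.continuous_coe)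
      have h0 : Real.sqrt (2 * ((0 : ℝ≥0) : ℝ)) = 0 := by simp
      have := hc.tendsto (0 : ℝ≥0)
      rw [h0] at this
      exact this.mono_left nhdsWithin_le_nhds
    · filter_upwards [self_mem_nhdsWithin] with t ht
      have ht' : (0 : ℝ) < t := by exact_mod_cast ht
      exact Real.sqrt_pos.2 (mul_pos two_pos ht')
  have hcomp : Tendsto (fun t : ℝ≥0 => (Real.sqrt (2 * t))⁻¹ *
      (φ (X + Real.sqrt (2 * t) • z) - φ X)) (𝓝[>] 0) (𝓝 (fderiv ℝ φ X z)) :=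
    hslope.comp hsqrt
  have hof := ENNReal.tendsto_ofReal (hcomp.pow 2)
  refine hof.congr' ?_
  filter_upwards [self_mem_nhdsWithin] with t ht
  have ht' : (0 : ℝ) < t := by exact_mod_cast ht
  have h2t : (0 : ℝ) < 2 * t := by positivity
  rw [mul_pow, ENNReal.ofReal_mul (sq_nonneg _), inv_pow, Real.sq_sqrt h2t.le,
    ENNReal.ofReal_inv_of_pos h2t]

/-- The rescaled integrand is measurable on `Config N × Config N` for each `t`. [folklore] -/
theorem measurable_sqIncr_integrand_smul {f : Config N → ℝ} (hf : Measurable f) (t : ℝ≥0) :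
    Measurable fun p : Config N × Config N => (ENNReal.ofReal (2 * t))⁻¹ *
      ENNReal.ofReal ((f (p.2 + Real.sqrt (2 * t) • p.1) - f p.2) ^ 2) := by
  have h1 : Measurable fun p : Config N × Config N => f (p.2 + Real.sqrt (2 * t) • p.1) :=
    hf.comp (measurable_snd.add (measurable_fst.const_smul (Real.sqrt (2 * t))))
  have h2 : Measurable fun p : Config N × Config N => f p.2 := hf.comp measurable_snd
  have h3 : Measurable fun p : Config N × Config N =>
      ENNReal.ofReal ((f (p.2 + Real.sqrt (2 * t) • p.1) - f p.2) ^ 2) :=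
    ENNReal.measurable_ofReal.comp ((h1.sub h2).pow_const 2)
  exact h3.const_mul ((ENNReal.ofReal (2 * t))⁻¹)

/-- **The Fatou lower bound**: for every `C¹` real function `φ` on `(ℝ³)^N`,
`∫ |∇φ|² ≤ liminf_{t → 0⁺} sqIncr t φ / (2t)`. [folklore] -/
theorem kinetic_le_liminf_sqIncr {φ : Config N → ℝ} (hφ : ContDiff ℝ 1 φ) :
    ∫⁻ Y, realKinetic φ Y ≤
      liminf (fun t : ℝ≥0 => (ENNReal.ofReal (2 * t))⁻¹ * sqIncr t φ) (𝓝[>] 0) := by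
  have hφm : Measurable φ := hφ.continuous.measurable
  set G : ℝ≥0 → Config N × Config N → ℝ≥0∞ := fun t p => (ENNReal.ofReal (2 * t))⁻¹ *
      ENNReal.ofReal ((φ (p.2 + Real.sqrt (2 * t) • p.1) - φ p.2) ^ 2) with hG
  have hGm : ∀ t, Measurable (G t) := fun t => measurable_sqIncr_integrand_smul hφm t
  -- the rescaled `sqIncr` as a product integral, for `t > 0`
  have hrepr : ∀ᶠ t : ℝ≥0 in 𝓝[>] 0, (ENNReal.ofReal (2 * t))⁻¹ * sqIncr t φ =
      ∫⁻ p, G t p ∂((stdGaussian N).prod volume) := by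
    filter_upwards [self_mem_nhdsWithin] with t ht
    have ht0 : t ≠ 0 := ne_of_gt ht
    rw [sqIncr_eq_lintegral_stdGaussian hφm ht0, lintegral_prod _ (hGm t).aemeasurable]
    simp only [hG]
    rw [← lintegral_const_mul' _ _ (ENNReal.inv_ne_top.2 ?_)]
    · refine lintegral_congr fun z => ?_
      rw [lintegral_const_mul' _ _ (ENNReal.inv_ne_top.2 ?_)]
      exact (ENNReal.ofReal_pos.2 (mul_pos two_pos (by exact_mod_cast ht))).ne'
    · exact (ENNReal.ofReal_pos.2 (mul_pos two_pos (by exact_mod_cast ht))).ne'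
  rw [liminf_congr hrepr]
  -- pointwise liminf
  have hpt : ∀ p : Config N × Config N, liminf (fun t => G t p) (𝓝[>] (0 : ℝ≥0)) =
      ENNReal.ofReal ((fderiv ℝ φ p.2 p.1) ^ 2) := fun p =>
    (tendsto_sqIncr_integrand hφ p.1 p.2).liminf_eq
  -- the left-hand side as a product integral
  have hlhs : ∫⁻ Y, realKinetic φ Y =
      ∫⁻ p, ENNReal.ofReal ((fderiv ℝ φ p.2 p.1) ^ 2) ∂((stdGaussian N).prod volume) := by
    have hm : Measurable fun p : Config N × Config N => ENNReal.ofReal ((fderiv ℝ φ p.2 p.1) ^ 2) := by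
      have hc : Continuous fun q : Config N × Config N => (fderiv ℝ φ q.2 q.1) ^ 2 :=
        (((hφ.continuous_fderiv one_ne_zero).comp continuous_snd).clm_apply continuous_fst).pow 2
      exact ENNReal.measurable_ofReal.comp hc.measurable
    rw [lintegral_prod_symm _ hm.aemeasurable]
    refine lintegral_congr fun Y => ?_
    rw [lintegral_clm_sq_stdGaussian (fderiv ℝ φ Y), realKinetic_eq_ofReal]
  rw [hlhs]
  calc ∫⁻ p, ENNReal.ofReal ((fderiv ℝ φ p.2 p.1) ^ 2) ∂((stdGaussian N).prod volume)
      = ∫⁻ p, liminf (fun t => G t p) (𝓝[>] (0 : ℝ≥0)) ∂((stdGaussian N).prod volume) :=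
        lintegral_congr fun p => (hpt p).symm
    _ ≤ liminf (fun t => ∫⁻ p, G t p ∂((stdGaussian N).prod volume)) (𝓝[>] (0 : ℝ≥0)) :=
        lintegral_liminf_le hGm

/-! ### Mollification does not increase `sqIncr` -/

/-- Averaging a bounded measurable function against a probability measure: the smoothed
function `x ↦ ∫ g(x - y) dν(y)` is measurable. [folklore] -/
theorem measurable_integral_sub {g : Config N → ℝ} (hg : Measurable g) (ν : Measure (Config N))
    [SFinite ν] : Measurable fun x : Config N => ∫ y, g (x - y) ∂ν := by
  have hm : Measurable fun p : Config N × Config N => g (p.1 - p.2) :=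
    hg.comp (measurable_fst.sub measurable_snd)
  exact (hm.stronglyMeasurable.integral_prod_right' (ν := ν)).measurable

/-- **Jensen for the smoothed increment**: with `u = g(· + h) - g`,
`(ḡ(X + h) - ḡ(X))² ≤ ∫ u(X - y)² dν(y)` where `ḡ = ∫ g(· - y) dν`. [folklore] -/
theorem sq_sub_conv_le {g : Config N → ℝ} (hg : Measurable g) {C : ℝ} (hC : ∀ x, |g x| ≤ C)
    (ν : Measure (Config N)) [IsProbabilityMeasure ν] (X h : Config N) :
    ((∫ y, g (X + h - y) ∂ν) - ∫ y, g (X - y) ∂ν) ^ 2 ≤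
      ∫ y, (g (X + h - y) - g (X - y)) ^ 2 ∂ν := by
  have hint : ∀ Z : Config N, Integrable (fun y => g (Z - y)) ν := fun Z =>
    Integrable.of_bound ((hg.comp (measurable_const.sub measurable_id)).aestronglyMeasurable) C
      (Eventually.of_forall fun y => by rw [Real.norm_eq_abs]; exact hC _)
  rw [← integral_sub (hint _) (hint _)]
  refine sq_integral_le_integral_sq ?_
  refine MemLp.of_bound (((hg.comp (measurable_const.sub measurable_id)).sub
    (hg.comp (measurable_const.sub measurable_id))).aestronglyMeasurable) (C + C)
    (Eventually.of_forall fun y => ?_)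
  rw [Real.norm_eq_abs]
  exact (abs_sub _ _).trans (add_le_add (hC _) (hC _))

/-- **Mollification does not increase the shift functional**:
`∫ (ḡ(X + h) - ḡ(X))² dX ≤ ∫ (g(X + h) - g(X))² dX`. [folklore] -/
theorem lintegral_sq_sub_conv_le {g : Config N → ℝ} (hg : Measurable g) {C : ℝ}
    (hC : ∀ x, |g x| ≤ C) (ν : Measure (Config N)) [IsProbabilityMeasure ν] (h : Config N) :
    ∫⁻ X, ENNReal.ofReal (((∫ y, g (X + h - y) ∂ν) - ∫ y, g (X - y) ∂ν) ^ 2) ≤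
      ∫⁻ X, ENNReal.ofReal ((g (X + h) - g X) ^ 2) := by
  have hmeas2 : Measurable fun p : Config N × Config N =>
      ENNReal.ofReal ((g (p.1 + h - p.2) - g (p.1 - p.2)) ^ 2) :=
    ENNReal.measurable_ofReal.comp (((hg.comp ((measurable_fst.add_const h).sub measurable_snd)).sub
      (hg.comp (measurable_fst.sub measurable_snd))).pow_const 2)
  calc ∫⁻ X, ENNReal.ofReal (((∫ y, g (X + h - y) ∂ν) - ∫ y, g (X - y) ∂ν) ^ 2)
      ≤ ∫⁻ X, ENNReal.ofReal (∫ y, (g (X + h - y) - g (X - y)) ^ 2 ∂ν) :=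
        lintegral_mono fun X => ENNReal.ofReal_le_ofReal (sq_sub_conv_le hg hC ν X h)
    _ = ∫⁻ X, ∫⁻ y, ENNReal.ofReal ((g (X + h - y) - g (X - y)) ^ 2) ∂ν := by
        refine lintegral_congr fun X => ?_
        refine ofReal_integral_eq_lintegral_ofReal ?_ (Eventually.of_forall fun y => sq_nonneg _)
        refine Integrable.of_bound ?_ ((C + C) ^ 2) (Eventually.of_forall fun y => ?_)
        · exact ((((hg.comp (measurable_const.sub measurable_id)).sub
            (hg.comp (measurable_const.sub measurable_id))).pow_const 2).aestronglyMeasurable)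
        · rw [Real.norm_eq_abs, abs_pow, sq_le_sq₀ (abs_nonneg _) (by
            linarith [abs_nonneg (g X), hC X])]
          exact (abs_sub _ _).trans (add_le_add (hC _) (hC _))
    _ = ∫⁻ y, ∫⁻ X, ENNReal.ofReal ((g (X + h - y) - g (X - y)) ^ 2) ∂volume ∂ν :=
        lintegral_lintegral_swap hmeas2.aemeasurable
    _ = ∫⁻ _y, ∫⁻ X, ENNReal.ofReal ((g (X + h) - g X) ^ 2) ∂volume ∂ν := by
        refine lintegral_congr fun y => ?_
        have htr : ∫⁻ X, ENNReal.ofReal ((g (X - y + h) - g (X - y)) ^ 2) =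
            ∫⁻ X, ENNReal.ofReal ((g (X + h) - g X) ^ 2) :=
          lintegral_sub_right_eq_self (μ := (volume : Measure (Config N)))
            (fun X => ENNReal.ofReal ((g (X + h) - g X) ^ 2)) y
        rw [← htr]
        refine lintegral_congr fun X => ?_
        rw [sub_add_eq_add_sub]
    _ = ∫⁻ X, ENNReal.ofReal ((g (X + h) - g X) ^ 2) := by
        rw [lintegral_const, measure_univ, mul_one]

/-- **Mollification does not increase `sqIncr`**: for a probability measure `ν` on `(ℝ³)^N` and a
bounded measurable `g`, the average `ḡ(x) = ∫ g(x - y) dν(y)` satisfies `sqIncr t ḡ ≤ sqIncr t g`.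
[folklore] -/
theorem sqIncr_conv_le {g : Config N → ℝ} (hg : Measurable g) {C : ℝ} (hC : ∀ x, |g x| ≤ C)
    (ν : Measure (Config N)) [IsProbabilityMeasure ν] (t : ℝ≥0) :
    sqIncr t (fun x => ∫ y, g (x - y) ∂ν) ≤ sqIncr t g :=
  lintegral_mono fun ω => lintegral_sq_sub_conv_le hg hC ν (displacement t ω)

/-! ### Dilation covariance -/

/-- `θ √(2t) = √(2 θ² t)` for `θ ≥ 0`. [folklore] -/
theorem mul_sqrt_two_mul (θ t : ℝ≥0) :
    (θ : ℝ) * Real.sqrt (2 * t) = Real.sqrt (2 * ((θ ^ 2 * t : ℝ≥0) : ℝ)) := by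
  push_cast
  rw [show (2 : ℝ) * (θ ^ 2 * t) = θ ^ 2 * (2 * t) by ring, Real.sqrt_mul (sq_nonneg _),
    Real.sqrt_sq θ.coe_nonneg]

/-- The shift functional of a dilated-translated function:
`S_{g(θ · + w)}(D) = θ^{-dim} S_g(θ D)`. [folklore] -/
theorem lintegral_shift_sq_dilate (g : Config N → ℝ) {θ : ℝ} (hθ : θ ≠ 0) (w D : Config N) :
    ∫⁻ X, ENNReal.ofReal ((g (θ • (X + D) + w) - g (θ • X + w)) ^ 2) =
      ENNReal.ofReal |(θ ^ Module.finrank ℝ (Config N))⁻¹| *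
        ∫⁻ Y, ENNReal.ofReal ((g (Y + θ • D) - g Y) ^ 2) := by
  have h1 : ∫⁻ X, ENNReal.ofReal ((g (θ • (X + D) + w) - g (θ • X + w)) ^ 2) =
      ∫⁻ X, (fun Y => ENNReal.ofReal ((g (Y + w + θ • D) - g (Y + w)) ^ 2)) (θ • X) := by
    refine lintegral_congr fun X => ?_
    simp only [smul_add]
    congr 3
    abel_nf
  have h2 := lintegral_comp_smul_config
    (fun Y => ENNReal.ofReal ((g (Y + w + θ • D) - g (Y + w)) ^ 2)) hθ
  have h3 : ∫⁻ Y, ENNReal.ofReal ((g (Y + w + θ • D) - g (Y + w)) ^ 2) =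
      ∫⁻ Y, ENNReal.ofReal ((g (Y + θ • D) - g Y) ^ 2) :=
    lintegral_add_right_eq_self (μ := (volume : Measure (Config N)))
      (fun Z => ENNReal.ofReal ((g (Z + θ • D) - g Z) ^ 2)) w
  rw [h1, h2, h3]

/-- **Exact dilation covariance of `sqIncr`**: for `θ > 0` and any translation `w`,
`sqIncr t (X ↦ g(θ X + w)) = θ^{-3N} · sqIncr (θ² t) g` (Haar scaling in `X`, then
`law(θ √2 b_t) = law(√2 b_{θ² t})` through the standard Gaussian). [folklore] -/
theorem sqIncr_dilate {g : Config N → ℝ} (hg : Measurable g) {θ : ℝ≥0} (hθ : θ ≠ 0)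
    (w : Config N) (t : ℝ≥0) :
    sqIncr t (fun X => g ((θ : ℝ) • X + w)) =
      ENNReal.ofReal |(((θ : ℝ)) ^ Module.finrank ℝ (Config N))⁻¹| * sqIncr (θ ^ 2 * t) g := by
  have hθ' : (θ : ℝ) ≠ 0 := by exact_mod_cast hθ
  -- inner Haar scaling
  have hinner : ∀ D : Config N, ∫⁻ X, ENNReal.ofReal ((g ((θ : ℝ) • (X + D) + w) -
      g ((θ : ℝ) • X + w)) ^ 2) = ENNReal.ofReal |(((θ : ℝ)) ^ Module.finrank ℝ (Config N))⁻¹| *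
        ∫⁻ Y, ENNReal.ofReal ((g (Y + (θ : ℝ) • D) - g Y) ^ 2) :=
    fun D => lintegral_shift_sq_dilate g hθ' w D
  unfold sqIncr
  simp_rw [hinner]
  rw [lintegral_const_mul' _ _ ENNReal.ofReal_ne_top]
  congr 1
  -- both sides through the standard Gaussian
  rcases eq_or_ne t 0 with rfl | ht
  · simp
  have hS := measurable_lintegral_shift_sq hg
  have hθt : θ ^ 2 * t ≠ 0 := mul_ne_zero (pow_ne_zero _ hθ) ht
  have lhs := lintegral_stdGaussian_smul (N := N) ht
    (F := fun D => ∫⁻ Y, ENNReal.ofReal ((g (Y + (θ : ℝ) • D) - g Y) ^ 2))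
    (hS.comp (measurable_const_smul _))
  have rhs := lintegral_stdGaussian_smul (N := N) hθt (F := fun D =>
    ∫⁻ Y, ENNReal.ofReal ((g (Y + D) - g Y) ^ 2)) hS
  rw [← lhs, ← rhs]
  refine lintegral_congr fun z => ?_
  rw [smul_smul, mul_sqrt_two_mul]

end Literature.MathematicalPhysics.QuantumManyBody.BoseGas

end
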